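import Literature.AnabelianGeometry.AbsoluteAnabelian.ArchimedeanHolFieldFunctorGeometricPSLGammaTwoUniformisation
import Literature.NumberTheory.Automorphic.ModularLambdaRoot
import HarnessLib

/-!
# `ℍ/Γ̄_N ≅ ℂ ∖ ({0} ∪ 16^{-1/N} μ_N)`: the Fermat-group bases, uniformised by `x_N = (λ/16)^{1/N}` (PROOF-ONLY)

abc-iut cell, row «LAMBDA-ROOT-BASES» (lineage abc-iut-L4-d1; sequel of
`…PSLGammaTwoUniformisation.lean`, same template with Legendre's `λ` replaced by the Calegari–Dimitrov–Tang
uniformiser `x_N = (λ/16)^{1/N}` of the tree's `Literature/NumberTheory/Automorphic/ModularLambdaRoot.lean`).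
S. Mochizuki, *Topics in Absolute Anabelian Geometry III*, Def. 4.1 (i) p. 101 (objects of `EA` =
hyperbolic Riemann surfaces), proof of Prop. 4.2 (i) p. 106 («objects that map to `X` … identified with
the category of finite étale R-localizations `Loc_R(X)`»).  For every `N ≥ 1` the tree PROVES that

  `x_N : ℍ → ℂ ∖ F_N`,  `F_N := {0} ∪ {u | 16 uᴺ = 1}`  (the centre and the vertices of a regular `N`-gon),

is the quotient covering map of its deck group `Λ_N = modularLambdaRootDeck N ≤ ⟨T², S T² S⁻¹⟩ ≤ Γ(2)`
(the groups of the Fermat curves; non-congruence for `N ∉ {1, 2, 4, 8}`), with fibres = `Λ_N`-orbits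
and a free action (`isCoveringMapOn_modularLambdaRoot`, `modularLambdaRoot_eq_modularLambdaRoot_iff`,
`isCancelSMul_modularLambdaRootDeck`, `exists_modularLambdaRoot_smul_eq`).  Consequences here, with

  `Γ̄_N := π(Λ_N) = ((modularLambdaRootDeck N).map (SL₂(ℤ) → SL₂(ℝ))).map π ≤ PSL₂(ℝ)` (spelled out):

* §1 the finite set `F_N` (`finite_lambdaRootCusps`, `two_le_ncard_lambdaRootCusps`,
  `setOf_ne_zero_and_pow_ne_eq_compl`) and `x_N` as a holomorphic covering of abc-iut-L4-t12's object
  `planeComplFinite F_N` (`isCoveringMap_/mdifferentiable_modularLambdaRoot_planeComplFinite`);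
* §2 `eq_pslLambdaRootDeck_of_deck_modularLambdaRoot` — the Möbius deck group of `x_N` IS `Γ̄_N`;
* §3 ★ `pslLambdaRootDeck_uniformisation` — `Γ̄_N` acts properly discontinuously and freely on `ℍ`, `x_N` is
  the quotient covering map for it, `π₁(ℂ ∖ F_N, x) ≃* Γ̄_N`, `Γ̄_N ≃* FreeGroup (Fin |F_N|)`, an ISOMORPHISM
  `pslQuotient Γ̄_N ≅ planeComplFinite F_N` of `HolRS` (`[τ] ↦ x_N τ`) and the transport equalities
  «maps to `ℍ/Γ̄_N`» = «maps to `ℂ ∖ F_N`» in `HolRS` and in the RC-category;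
* §4 ★ `finiteIndex_modularLambdaRootDeck` — `Λ_N` has FINITE INDEX in `SL₂(ℤ)` (`[Γ(2) : Λ] ≤ 2` from
  `Γ(2) = Λ ∪ (−1)Λ`; `[Λ : Λ_N] ≤ N` from the character `x_N ∘ γ = ζ^k x_N`), so `Γ̄_N` is ARITHMETIC
  via abc-iut-L4-t12's `isArithmetic_map_comap_of_subgroup_SL2Z`.

Hence (sequel file) [AbsTopIII] Prop 4.2 (i) / Cor 4.5 hold with ZERO hypotheses at the infinite family
of GENUINE plane domains `X_N = ℂ ∖ F_N` of types `(0, N + 2)`, `N ≥ 1` (`N = 1`: the tripod up to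
`u ↦ 16u`).  No definitions, no instances, no named facts.  HONEST FRAMING: plane domains only (no
`(1, 1)` curve is reached this way); MODEL side of [AbsTopIII] §4 — model ≠ reconstruction; classical
(CDT 2025 §3 proof of Prop. 15; Farkas–Kra IV.5); nothing here bears on the disputed [IUTchIII] Cor. 3.12.

## References

* S. Mochizuki, *Topics in Absolute Anabelian Geometry III* (2015), Def. 4.1 (i) p. 101, proof of
  Prop. 4.2 (i) p. 106. [MochizukiAbsTopIII2015]
* F. Calegari, V. Dimitrov, Y. Tang, *The unbounded denominators conjecture*, JAMS 38 (2025), §1 p. 3,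
  §3 proof of Prop. 15. [CalegariDimitrovTang2025]
* H. M. Farkas, I. Kra, *Riemann Surfaces*, 2nd ed. (1992), IV.5.5–IV.5.6. [FarkasKra1992]
-/

set_option autoImplicit false

noncomputable section

open scoped Manifold ContDiff Topology UpperHalfPlane MatrixGroups
open _root_.MulAction _root_.CategoryTheory _root_.TopologicalSpace

namespace Literature.AnabelianGeometry.AbsoluteAnabelian

namespace HolRS

open Literature.NumberTheory.Automorphic (modularLambda)
open Literature.NumberTheory.Automorphic.ModularLambda

/-! ### §1 The finite set `F_N = {0} ∪ {u | 16 uᴺ = 1}` and the root uniformiser as a covering of `ℂ ∖ F_N` -/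

/-- `{u | 16 uᴺ = 1}` is finite (`N ≠ 0`): roots of the non-zero polynomial `16 Xᴺ − 1`.
[cite: CalegariDimitrovTang2025, §3, proof of Proposition 15] -/
theorem finite_setOf_sixteen_mul_pow_eq_one {N : ℕ} (hN : N ≠ 0) :
    ({u : ℂ | 16 * u ^ N = 1} : Set ℂ).Finite := by
  have hp : (Polynomial.C (16 : ℂ) * Polynomial.X ^ N - 1 : Polynomial ℂ) ≠ 0 := by
    intro h
    have := congrArg (Polynomial.eval (0 : ℂ)) h
    simp [zero_pow hN] at this
  refine (Polynomial.finite_setOf_isRoot hp).subset fun u hu => ?_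
  simp only [Set.mem_setOf_eq] at hu ⊢
  simp [Polynomial.IsRoot, hu]

/-- `F_N = {0} ∪ {u | 16 uᴺ = 1}` is finite. [cite: CalegariDimitrovTang2025, §3, proof of Proposition 15] -/
theorem finite_lambdaRootCusps {N : ℕ} (hN : N ≠ 0) :
    (insert (0 : ℂ) {u : ℂ | 16 * u ^ N = 1}).Finite :=
  (finite_setOf_sixteen_mul_pow_eq_one hN).insert 0

/-- `F_N` has at least two points (`0` and an `N`-th root of `1/16`). [cite: CalegariDimitrovTang2025, §3, proof of Proposition 15] -/
theorem two_le_ncard_lambdaRootCusps {N : ℕ} (hN : N ≠ 0) :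
    2 ≤ (insert (0 : ℂ) {u : ℂ | 16 * u ^ N = 1}).ncard := by
  obtain ⟨z, hz⟩ := IsAlgClosed.exists_pow_nat_eq (1 / 16 : ℂ) (Nat.pos_of_ne_zero hN)
  have hz1 : 16 * z ^ N = 1 := by rw [hz]; norm_num
  have hz0 : z ≠ 0 := by
    rintro rfl
    rw [zero_pow hN] at hz1
    norm_num at hz1
  calc 2 = ({0, z} : Set ℂ).ncard := (Set.ncard_pair hz0.symm).symm
    _ ≤ _ := Set.ncard_le_ncard (by
        intro u hu
        rcases hu with rfl | rfl
        · exact Set.mem_insert _ _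
        · exact Set.mem_insert_of_mem _ hz1) (finite_lambdaRootCusps hN)

/-- The tree's target set `{u | u ≠ 0 ∧ 16 uᴺ ≠ 1}` is the complement of `F_N`. [cite: CalegariDimitrovTang2025, §3, proof of Proposition 15] -/
theorem setOf_ne_zero_and_pow_ne_eq_compl (N : ℕ) :
    ({u : ℂ | u ≠ 0 ∧ 16 * u ^ N ≠ 1} : Set ℂ) = (insert (0 : ℂ) {u : ℂ | 16 * u ^ N = 1})ᶜ := by
  ext u
  simp only [Set.mem_setOf_eq, Set.mem_compl_iff, Set.mem_insert_iff, not_or]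

/-- `x_N(τ) ∈ ℂ ∖ F_N`. [cite: CalegariDimitrovTang2025, §3, proof of Proposition 15] -/
theorem modularLambdaRoot_mem_compl {N : ℕ} (hN : N ≠ 0) (τ : ℍ) :
    modularLambdaRoot N τ ∈ (⟨(insert (0 : ℂ) {u : ℂ | 16 * u ^ N = 1})ᶜ,
      (finite_lambdaRootCusps hN).isClosed.isOpen_compl⟩ : Opens ℂ) := by
  change modularLambdaRoot N τ ∈ (insert (0 : ℂ) {u : ℂ | 16 * u ^ N = 1})ᶜ
  rw [← setOf_ne_zero_and_pow_ne_eq_compl]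
  exact ⟨modularLambdaRoot_ne_zero N τ, sixteen_mul_modularLambdaRoot_pow_ne_one hN τ⟩

/-- **`x_N : ℍ → ℂ ∖ F_N` is a covering map of the object `planeComplFinite F_N`** (the tree's
`isCoveringMapOn_modularLambdaRoot`, read in `HolRS`). [cite: CalegariDimitrovTang2025, §3, proof of Proposition 15] -/
theorem isCoveringMap_modularLambdaRoot_planeComplFinite {N : ℕ} (hN : N ≠ 0) :
    IsCoveringMap (fun τ : ℍ => (⟨modularLambdaRoot N τ, modularLambdaRoot_mem_compl hN τ⟩ :
      (planeComplFinite (insert (0 : ℂ) {u : ℂ | 16 * u ^ N = 1}) (finite_lambdaRootCusps hN)).carrier)) := by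
  have hOn : IsCoveringMapOn (modularLambdaRoot N) ((insert (0 : ℂ) {u : ℂ | 16 * u ^ N = 1})ᶜ) := by
    rw [← setOf_ne_zero_and_pow_ne_eq_compl]
    exact isCoveringMapOn_modularLambdaRoot hN
  have h1 := hOn.isCoveringMap_restrictPreimage
  have huniv : modularLambdaRoot N ⁻¹' (insert (0 : ℂ) {u : ℂ | 16 * u ^ N = 1})ᶜ = Set.univ :=
    Set.eq_univ_of_forall fun τ => modularLambdaRoot_mem_compl hN τ
  let e : ℍ ≃ₜ ↥(modularLambdaRoot N ⁻¹' (insert (0 : ℂ) {u : ℂ | 16 * u ^ N = 1})ᶜ) :=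
    (Homeomorph.Set.univ ℍ).symm.trans (Homeomorph.setCongr huniv.symm)
  have h2 : IsCoveringMapOn
      (((insert (0 : ℂ) {u : ℂ | 16 * u ^ N = 1})ᶜ.restrictPreimage (modularLambdaRoot N)) ∘ e)
      Set.univ :=
    (isCoveringMap_iff_isCoveringMapOn_univ.mp h1).comp_homeomorph e
  exact isCoveringMap_iff_isCoveringMapOn_univ.mpr h2

/-- `x_N` is holomorphic as a map into `planeComplFinite F_N`. [cite: CalegariDimitrovTang2025, §3, proof of Proposition 15] -/
theorem mdifferentiable_modularLambdaRoot_planeComplFinite {N : ℕ} (hN : N ≠ 0) :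
    MDifferentiable 𝓘(ℂ, ℂ) 𝓘(ℂ, ℂ) (fun τ : ℍ => (⟨modularLambdaRoot N τ, modularLambdaRoot_mem_compl hN τ⟩ :
      (planeComplFinite (insert (0 : ℂ) {u : ℂ | 16 * u ^ N = 1}) (finite_lambdaRootCusps hN)).carrier)) := by
  set k : ℍ → (planeComplFinite (insert (0 : ℂ) {u : ℂ | 16 * u ^ N = 1}) (finite_lambdaRootCusps hN)).carrier :=
    fun τ => ⟨modularLambdaRoot N τ, modularLambdaRoot_mem_compl hN τ⟩ with hk_def
  intro x
  have h1 : MDifferentiableAt 𝓘(ℂ, ℂ) 𝓘(ℂ, ℂ) (Subtype.val ∘ k) x ↔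
      MDifferentiableAt 𝓘(ℂ, ℂ) 𝓘(ℂ, ℂ) k x :=
    ChartedSpace.liftPropWithinAt_subtypeVal_comp_iff ..
  exact h1.mp (mdifferentiable_modularLambdaRoot N x)

/-! ### §2 The Möbius deck group of `x_N` is `Γ̄_N = π(Λ_N)` -/

/-- Membership in `Γ̄_N = π(Λ_N)`. [cite: FarkasKra1992, IV.5.6] -/
theorem mem_pslLambdaRootDeck_iff {N : ℕ} {q : PSL2R} :
    q ∈ ((modularLambdaRootDeck N).map (Matrix.SpecialLinearGroup.map (Int.castRingHom ℝ))).map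
        (QuotientGroup.mk' (Subgroup.center SL(2, ℝ))) ↔
      ∃ γ ∈ modularLambdaRootDeck N,
        (QuotientGroup.mk (Matrix.SpecialLinearGroup.map (Int.castRingHom ℝ) γ) : PSL2R) = q := by
  simp only [Subgroup.mem_map, QuotientGroup.mk'_apply, exists_exists_and_eq_and]

/-- **The Möbius deck group of `x_N` is `Γ̄_N`**: a subgroup of `PSL₂(ℝ)` acting freely on `ℍ` with
membership criterion `x_N(q • τ) = x_N(τ)` equals `π(Λ_N)` (`⊇`: definition of `Λ_N`; `⊆`: fibres of
`x_N` are `Λ_N`-orbits, and a freely acting element with a fixed point is trivial).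
[cite: CalegariDimitrovTang2025, §3, proof of Proposition 15] [cite: FarkasKra1992, IV.5.5–IV.5.6] -/
theorem eq_pslLambdaRootDeck_of_deck_modularLambdaRoot {N : ℕ} (hN : N ≠ 0) (Λ : Subgroup PSL2R)
    [IsCancelSMul Λ ℍ]
    (hΛ : ∀ q : PSL2R, q ∈ Λ ↔ ∀ τ : ℍ, modularLambdaRoot N (q • τ) = modularLambdaRoot N τ) :
    Λ = ((modularLambdaRootDeck N).map (Matrix.SpecialLinearGroup.map (Int.castRingHom ℝ))).map
        (QuotientGroup.mk' (Subgroup.center SL(2, ℝ))) := by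
  have hsub : ∀ γ ∈ modularLambdaRootDeck N,
      (QuotientGroup.mk (Matrix.SpecialLinearGroup.map (Int.castRingHom ℝ) γ) : PSL2R) ∈ Λ :=
    fun γ hγ => (hΛ _).mpr fun τ => by rw [mk_map_intCast_smul]; exact hγ.2 τ
  ext q
  refine ⟨fun hq => ?_, fun hq => ?_⟩
  · obtain ⟨γ, hγ, hγI⟩ :=
      (modularLambdaRoot_eq_modularLambdaRoot_iff hN).mp ((hΛ q).mp hq UpperHalfPlane.I)
    set p : PSL2R := QuotientGroup.mk (Matrix.SpecialLinearGroup.map (Int.castRingHom ℝ) γ) with hp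
    have hpΛ : p ∈ Λ := hsub γ hγ
    have hfix : (⟨p * q, Λ.mul_mem hpΛ hq⟩ : Λ) • UpperHalfPlane.I = UpperHalfPlane.I := by
      change (p * q) • UpperHalfPlane.I = UpperHalfPlane.I
      rw [mul_smul, hp, mk_map_intCast_smul]
      exact hγI
    have h1 : (⟨p * q, Λ.mul_mem hpΛ hq⟩ : Λ) = 1 := IsCancelSMul.eq_one_of_smul hfix
    have hpq : p * q = 1 := congrArg Subtype.val h1
    rw [eq_inv_of_mul_eq_one_right hpq]
    exact Subgroup.inv_mem _ (mem_pslLambdaRootDeck_iff.mpr ⟨γ, hγ, rfl⟩)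
  · obtain ⟨γ, hγ, rfl⟩ := mem_pslLambdaRootDeck_iff.mp hq
    exact hsub γ hγ

/-! ### §3 `Γ̄_N` uniformises `ℂ ∖ F_N` -/

/-- ★ **`ℍ/Γ̄_N ≅ ℂ ∖ ({0} ∪ 16^{-1/N}μ_N)` by `x_N = (λ/16)^{1/N}`**, with everything the geometric column
consumes: `Γ̄_N = π(Λ_N)` acts properly discontinuously and freely on `ℍ`; `x_N` is the quotient covering
map; `π₁(ℂ ∖ F_N, x) ≃* Γ̄_N`; `Γ̄_N ≃* FreeGroup (Fin |F_N|)`; an ISOMORPHISM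
`pslQuotient Γ̄_N ≅ planeComplFinite F_N` of `HolRS`, `[τ] ↦ x_N τ`; and the transport equalities of the
object properties «maps to `ℍ/Γ̄_N`» = «maps to `ℂ ∖ F_N`» in `HolRS` and in the RC-category.
[cite: MochizukiAbsTopIII2015, Proposition 4.2 (i) proof p.106] [cite: CalegariDimitrovTang2025, §3, proof of Proposition 15]
[cite: FarkasKra1992, IV.5.5–IV.5.6] -/
theorem pslLambdaRootDeck_uniformisation {N : ℕ} (hN : N ≠ 0) :
    ∃ (_ : ProperlyDiscontinuousSMul
        (((modularLambdaRootDeck N).map (Matrix.SpecialLinearGroup.map (Int.castRingHom ℝ))).map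
          (QuotientGroup.mk' (Subgroup.center SL(2, ℝ)))) ℍ)
      (_ : IsCancelSMul
        (((modularLambdaRootDeck N).map (Matrix.SpecialLinearGroup.map (Int.castRingHom ℝ))).map
          (QuotientGroup.mk' (Subgroup.center SL(2, ℝ)))) ℍ),
      IsQuotientCoveringMap (fun τ : ℍ => (⟨modularLambdaRoot N τ, modularLambdaRoot_mem_compl hN τ⟩ :
          (planeComplFinite (insert (0 : ℂ) {u : ℂ | 16 * u ^ N = 1}) (finite_lambdaRootCusps hN)).carrier))
        (((modularLambdaRootDeck N).map (Matrix.SpecialLinearGroup.map (Int.castRingHom ℝ))).map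
          (QuotientGroup.mk' (Subgroup.center SL(2, ℝ)))) ∧
      (∀ x : (planeComplFinite (insert (0 : ℂ) {u : ℂ | 16 * u ^ N = 1}) (finite_lambdaRootCusps hN)).carrier,
        Nonempty (FundamentalGroup
          (planeComplFinite (insert (0 : ℂ) {u : ℂ | 16 * u ^ N = 1}) (finite_lambdaRootCusps hN)).carrier x ≃*
          (((modularLambdaRootDeck N).map (Matrix.SpecialLinearGroup.map (Int.castRingHom ℝ))).map
            (QuotientGroup.mk' (Subgroup.center SL(2, ℝ)))))) ∧
      Nonempty ((((modularLambdaRootDeck N).map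
          (Matrix.SpecialLinearGroup.map (Int.castRingHom ℝ))).map
            (QuotientGroup.mk' (Subgroup.center SL(2, ℝ)))) ≃*
          FreeGroup (Fin (insert (0 : ℂ) {u : ℂ | 16 * u ^ N = 1}).ncard)) ∧
      (∃ e : pslQuotient (((modularLambdaRootDeck N).map
            (Matrix.SpecialLinearGroup.map (Int.castRingHom ℝ))).map
              (QuotientGroup.mk' (Subgroup.center SL(2, ℝ)))) ≅
          planeComplFinite (insert (0 : ℂ) {u : ℂ | 16 * u ^ N = 1}) (finite_lambdaRootCusps hN),
        ∀ τ : ℍ, e.hom.toFun (Quotient.mk _ τ) =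
          (⟨modularLambdaRoot N τ, modularLambdaRoot_mem_compl hN τ⟩ :
            (planeComplFinite (insert (0 : ℂ) {u : ℂ | 16 * u ^ N = 1}) (finite_lambdaRootCusps hN)).carrier)) ∧
      ((fun Y : HolRS => Nonempty (Y ⟶ pslQuotient (((modularLambdaRootDeck N).map
            (Matrix.SpecialLinearGroup.map (Int.castRingHom ℝ))).map
              (QuotientGroup.mk' (Subgroup.center SL(2, ℝ)))))) =
        fun Y : HolRS => Nonempty (Y ⟶
          planeComplFinite (insert (0 : ℂ) {u : ℂ | 16 * u ^ N = 1}) (finite_lambdaRootCusps hN))) ∧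
      ((fun Y : RC => Nonempty (Y ⟶ toRC.obj (pslQuotient (((modularLambdaRootDeck N).map
            (Matrix.SpecialLinearGroup.map (Int.castRingHom ℝ))).map
              (QuotientGroup.mk' (Subgroup.center SL(2, ℝ))))))) =
        fun Y : RC => Nonempty (Y ⟶ toRC.obj
          (planeComplFinite (insert (0 : ℂ) {u : ℂ | 16 * u ^ N = 1}) (finite_lambdaRootCusps hN)))) := by
  set X : HolRS := planeComplFinite (insert (0 : ℂ) {u : ℂ | 16 * u ^ N = 1}) (finite_lambdaRootCusps hN)
    with hX
  set k : ℍ → X.carrier := fun τ => ⟨modularLambdaRoot N τ, modularLambdaRoot_mem_compl hN τ⟩ with hk_def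
  have hk : IsCoveringMap k := isCoveringMap_modularLambdaRoot_planeComplFinite hN
  have dk : MDifferentiable 𝓘(ℂ, ℂ) 𝓘(ℂ, ℂ) k := mdifferentiable_modularLambdaRoot_planeComplFinite hN
  obtain ⟨Λ, hPD, hC, hΛ, -, hq, e, he⟩ := exists_pslQuotient_iso_of_cover X hk dk
  obtain ⟨Λ', hPD', hC', hΛ', hπ, -, hH, hR⟩ := exists_pslQuotient_iso_of_cover_transport X hk dk
  have hΛ1 : ∀ q : PSL2R, q ∈ Λ ↔ ∀ τ : ℍ, modularLambdaRoot N (q • τ) = modularLambdaRoot N τ :=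
    fun q => (hΛ q).trans (forall_congr' fun τ => Subtype.ext_iff)
  have hΛ2 : ∀ q : PSL2R, q ∈ Λ' ↔ ∀ τ : ℍ, modularLambdaRoot N (q • τ) = modularLambdaRoot N τ :=
    fun q => (hΛ' q).trans (forall_congr' fun τ => Subtype.ext_iff)
  have h1 := eq_pslLambdaRootDeck_of_deck_modularLambdaRoot hN Λ hΛ1
  have h2 := eq_pslLambdaRootDeck_of_deck_modularLambdaRoot hN Λ' hΛ2
  subst h1
  subst h2
  obtain ⟨x⟩ : Nonempty X.carrier := inferInstance
  obtain ⟨φ⟩ := hπ x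
  obtain ⟨ψ⟩ :=
    Literature.AlgebraicTopology.FundamentalGroup.nonempty_mulEquiv_freeGroup_compl_finite
      (finite_lambdaRootCusps hN) x
  exact ⟨hPD, hC, hq, hπ, ⟨φ.symm.trans ψ⟩, ⟨e, he⟩, hH, hR⟩

/-! ### §4 `Λ_N` has finite index in `SL₂(ℤ)` (so `Γ̄_N` is ARITHMETIC) -/

/-- `[Γ(2) : Λ] < ∞` for `Λ = ⟨T², S T² S⁻¹⟩`: `Γ(2) = Λ ∪ (−1)Λ` (the tree's
`mem_closure_T_sq_or_neg_mem`). [cite: CalegariDimitrovTang2025, §1 p. 3] -/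
theorem finiteIndex_closure_T_sq_subgroupOf_Gamma_two :
    ((Subgroup.closure ({ModularGroup.T ^ 2, ModularGroup.S * ModularGroup.T ^ 2 * ModularGroup.S⁻¹} :
        Set SL(2, ℤ))).subgroupOf (CongruenceSubgroup.Gamma 2)).FiniteIndex := by
  set Λ := Subgroup.closure ({ModularGroup.T ^ 2, ModularGroup.S * ModularGroup.T ^ 2 *
    ModularGroup.S⁻¹} : Set SL(2, ℤ)) with hΛ
  have hneg : (-1 : SL(2, ℤ)) ∈ CongruenceSubgroup.Gamma 2 := by
    rw [CongruenceSubgroup.Gamma_mem]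
    refine ⟨?_, ?_, ?_, ?_⟩ <;> simp
  let f : Bool → (CongruenceSubgroup.Gamma 2) ⧸ Λ.subgroupOf (CongruenceSubgroup.Gamma 2) :=
    fun b => cond b (QuotientGroup.mk 1) (QuotientGroup.mk ⟨-1, hneg⟩)
  haveI : Finite ((CongruenceSubgroup.Gamma 2) ⧸ Λ.subgroupOf (CongruenceSubgroup.Gamma 2)) := by
    refine Finite.of_surjective f fun q => ?_
    induction q using QuotientGroup.induction_on with
    | H g =>
      rcases mem_closure_T_sq_or_neg_mem g.2 with h | h
      · refine ⟨true, ?_⟩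
        change (QuotientGroup.mk 1 : (CongruenceSubgroup.Gamma 2) ⧸ Λ.subgroupOf _) = QuotientGroup.mk g
        rw [QuotientGroup.eq, inv_one, one_mul, Subgroup.mem_subgroupOf]
        exact h
      · refine ⟨false, ?_⟩
        change (QuotientGroup.mk ⟨-1, hneg⟩ : (CongruenceSubgroup.Gamma 2) ⧸ Λ.subgroupOf _) =
          QuotientGroup.mk g
        rw [QuotientGroup.eq, Subgroup.mem_subgroupOf]
        have : ((⟨-1, hneg⟩ : CongruenceSubgroup.Gamma 2)⁻¹ * g : CongruenceSubgroup.Gamma 2) =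
            ((-(g : SL(2, ℤ))) : SL(2, ℤ)) := by
          rw [Subgroup.coe_mul, Subgroup.coe_inv]
          have h1 : ((-1 : SL(2, ℤ)))⁻¹ = -1 :=
            inv_eq_of_mul_eq_one_right (by rw [neg_mul_neg, one_mul])
          rw [h1, neg_mul, one_mul]
        rw [this]
        exact h
  exact Subgroup.finiteIndex_of_finite_quotient

/-- `[Λ : Λ_N] < ∞`: on `Λ` the uniformiser transforms by a character with values in the `N`-th roots
of unity (`x_N ∘ γ = ζ^k x_N`, tree `exists_modularLambdaRoot_smul_eq`), whose kernel is `Λ_N`.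
[cite: CalegariDimitrovTang2025, §3, proof of Proposition 15] -/
theorem finiteIndex_modularLambdaRootDeck_subgroupOf_closure {N : ℕ} (hN : N ≠ 0) :
    ((modularLambdaRootDeck N).subgroupOf (Subgroup.closure ({ModularGroup.T ^ 2,
      ModularGroup.S * ModularGroup.T ^ 2 * ModularGroup.S⁻¹} : Set SL(2, ℤ)))).FiniteIndex := by
  classical
  set Λ := Subgroup.closure ({ModularGroup.T ^ 2, ModularGroup.S * ModularGroup.T ^ 2 *
    ModularGroup.S⁻¹} : Set SL(2, ℤ)) with hΛ
  set ζ : ℂ := Complex.exp (2 * Real.pi * Complex.I / N) with hζ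
  -- the character `γ ↦ x_N(γ • i) / x_N(i)`
  have hx0 : modularLambdaRoot N UpperHalfPlane.I ≠ 0 := modularLambdaRoot_ne_zero N _
  -- its value is a power of `ζ`, and governs `x_N ∘ γ` everywhere
  have key : ∀ γ : Λ, ∃ k : ℕ, (∀ τ : ℍ, modularLambdaRoot N ((γ : SL(2, ℤ)) • τ) =
      ζ ^ k * modularLambdaRoot N τ) := fun γ => exists_modularLambdaRoot_smul_eq hN γ.2
  choose k hk using key
  -- the quotient injects into the finite set of powers of `ζ`
  let v : Λ ⧸ (modularLambdaRootDeck N).subgroupOf Λ → Fin N := fun q =>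
    ⟨k (Quotient.out q) % N, Nat.mod_lt _ (Nat.pos_of_ne_zero hN)⟩
  have hζN : ζ ^ N = 1 := exp_two_pi_I_div_pow N
  have hpow : ∀ m : ℕ, ζ ^ m = ζ ^ (m % N) := fun m => by
    conv_lhs => rw [← Nat.mod_add_div m N, pow_add, pow_mul, hζN, one_pow, mul_one]
  haveI : Finite (Λ ⧸ (modularLambdaRootDeck N).subgroupOf Λ) := by
    refine Finite.of_injective v fun q₁ q₂ hq => ?_
    have hk12 : ζ ^ k (Quotient.out q₁) = ζ ^ k (Quotient.out q₂) := by
      rw [hpow (k (Quotient.out q₁)), hpow (k (Quotient.out q₂))]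
      exact congrArg (fun i : Fin N => ζ ^ (i : ℕ)) hq
    rw [← Quotient.out_eq q₁, ← Quotient.out_eq q₂]
    refine QuotientGroup.eq.mpr ?_
    rw [Subgroup.mem_subgroupOf, mem_modularLambdaRootDeck_iff]
    refine ⟨(((Quotient.out q₁)⁻¹ * Quotient.out q₂ : Λ)).2, fun τ => ?_⟩
    -- `x(γ₁⁻¹ γ₂ τ) = x τ` from `ζ^{k₁} = ζ^{k₂}`
    have h2 := hk (Quotient.out q₂) τ
    have h1 := hk (Quotient.out q₁) (((Quotient.out q₁)⁻¹ * Quotient.out q₂ : Λ) • τ)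
    rw [Subgroup.smul_def, Subgroup.coe_mul, Subgroup.coe_inv, ← mul_smul, mul_inv_cancel_left] at h1
    rw [Subgroup.coe_mul, Subgroup.coe_inv]
    rw [h1, hk12] at h2
    have hζ0 : ζ ^ k (Quotient.out q₂) ≠ 0 := pow_ne_zero _ (Complex.exp_ne_zero _)
    exact mul_left_cancel₀ hζ0 h2
  exact Subgroup.finiteIndex_of_finite_quotient

/-- ★ **`Λ_N` has finite index in `SL₂(ℤ)`** — the Fermat groups are arithmetic (though non-congruence
for `N ∉ {1, 2, 4, 8}`). [cite: CalegariDimitrovTang2025, §3, proof of Proposition 15] -/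
theorem finiteIndex_modularLambdaRootDeck {N : ℕ} (hN : N ≠ 0) : (modularLambdaRootDeck N).FiniteIndex := by
  set Λ := Subgroup.closure ({ModularGroup.T ^ 2, ModularGroup.S * ModularGroup.T ^ 2 *
    ModularGroup.S⁻¹} : Set SL(2, ℤ)) with hΛ
  have h1 : (modularLambdaRootDeck N).index =
      ((modularLambdaRootDeck N).subgroupOf Λ).index * Λ.index :=
    (Subgroup.relIndex_mul_index (modularLambdaRootDeck_le_closure N)).symm
  have h2 : Λ.index = (Λ.subgroupOf (CongruenceSubgroup.Gamma 2)).index *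
      (CongruenceSubgroup.Gamma 2).index :=
    (Subgroup.relIndex_mul_index closure_T_sq_le_Gamma_two).symm
  refine ⟨?_⟩
  rw [h1, h2]
  haveI := finiteIndex_modularLambdaRootDeck_subgroupOf_closure hN
  haveI := finiteIndex_closure_T_sq_subgroupOf_Gamma_two
  exact mul_ne_zero Subgroup.FiniteIndex.index_ne_zero
    (mul_ne_zero Subgroup.FiniteIndex.index_ne_zero Subgroup.FiniteIndex.index_ne_zero)

end HolRS

end Literature.AnabelianGeometry.AbsoluteAnabelian

end
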